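/-
Copyright (c) 2026 the pub-hodgecm-mathlib formalisation cell (harness21).  Prover seat hodgecm-mathlib-R90-C133-p03 (g2), Track B ∕ K2-LIT, h413 = `stmt-HodgeConjecture-24833`,
R90-TF section S5 «Ch13.3 mult∕rigidity» (deal R90-C133-plan (g2) 2026-09-04T22:51:42Z «`hu`-DISCHARGER PAIR for the (ℓ8) U-twin cascade», LEAD #33 (B)): (U-2) a one-dimensional
smooth representation `ℂ_χ` with `χ` UNITARY is unitarizable (converse of ★ (U-1)), and (U-2ξ) the instance at Rogawski's `ξ_v` on `H_v = U(Φ₂)(L⁺_v) × U(Φ₁)(L⁺_v)`.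
-/
import Summits.HodgeConjecture.HodgeConjecture.Theorems.R90S5DiscHNonexceptionalOfExcludedNotUnitarizable   -- ★ p861712 (U-1) `norm_eq_one_of_isUnitarizable_ofChar`, (U-box); brings ★ `SmoothIrrep.ofChar`, ★ `IrrClass.IsUnitarizable`, ★ `OneDimAutRepH.xiLocalChar`
import Summits.HodgeConjecture.HodgeConjecture.Theorems.F0P3XiLocalCharOpenKernel                             -- ★ `isOpen_ker_xiLocalChar` (the open-kernel proof every `SmoothIrrep.ofChar (ξ.xiLocalChar v) _` consumer passes)
import Literature.NumberTheory.Automorphic.MatrixCoefficientsTrivialRep                                       -- ★ `Representation.isUnitarizable_trivial`, ★ `Representation.norm_eq_one_of_isUnitarizable_twist`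
import HarnessLib

/-!
# R90-TF · S5 — `R90S5OfCharUnitarizable`: (U-2) `‖χ‖ = 1 ⟹ ⟦ℂ_χ⟧` UNITARIZABLE, the `iff` with ★ (U-1), and (U-2ξ) `⟦ℂ_{ξ_v}⟧` is unitarizable for every
# one-dimensional automorphic `ξ` of `H = U(2) × U(1)` — the `hu`-discharger of the (ℓ8) U-twin cascade

Cell `hodgecm-mathlib`, crux H413 = `stmt-HodgeConjecture-24833`, route of record `HCCMUnconditional`; R90-TF section S5 (base `R90-C133`), seat R90-C133-p03 (g2); deal of the S5
dealer R90-C133-plan (g2) 2026-09-04T22:51:42Z (LEAD #33 (B): the U-twins `OneDimHLawU` ∕ `rhoXiU` ∕ `charPacketU` ∕ `packetHOfOneDimU` apply the one-dimensional H-law only at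
`r = ℂ_{ξ_v}` and must supply `hu : (IrrClass.mk r).IsUnitarizable`; the tree had ★ (U-1) `norm_eq_one_of_isUnitarizable_ofChar` — the WRONG direction — ★ (U-box) and ★
`OneDimAutRepH.norm_xiLocalChar_apply_eq_one`, but not the converse).  THEOREMS ONLY (no `def`, no `instance`, no `notation`, no named-fact hypothesis, no `sorry`; default
heartbeats); lane `--supports stmt-HodgeConjecture-24833 --as helper` (count-neutral).  R0 census (dealer's list): `rg 'ofChar'` over `Literature/NumberTheory/Automorphic/*Unitar*`,
★ `MatrixCoefficientsTrivialRep` (:158 `isUnitarizable_trivial`, :205 `norm_eq_one_of_isUnitarizable_twist` = (U-1) at representation level), ★ `SmoothCharacterUnitaryBound` — NO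
converse in tree ⇒ both heads are new.
* §1 (representation level, any group) **`isUnitarizable_trivial_twist_of_norm_eq_one`**: `‖χ g‖ = 1 ∀ g ⟹ ((trivial ℂ G ℂ).twist χ).IsUnitarizable` — the form is Mathlib's
  inner product on `ℂ` (★ `isUnitarizable_trivial`'s witness), invariant because `conj(χ g)·χ g = ‖χ g‖² = 1`; `…_iff` with ★ `norm_eq_one_of_isUnitarizable_twist`.
* §2 (class level, topological group) **(U-2) `isUnitarizable_mk_ofChar_of_norm_eq_one`**: `(IrrClass.mk (SmoothIrrep.ofChar χ hχ)).IsUnitarizable` (★ `isUnitarizable_mk` +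
  ★ `SmoothIrrep.ofChar_ρ`); **`isUnitarizable_mk_ofChar_iff`** = (U-2) ∧ ★ (U-1).
* §3 (CM, `H_v`) **(U-2ξ) `isUnitarizable_mk_ofChar_xiLocalChar (ξ) (v)`**: `(IrrClass.mk (SmoothIrrep.ofChar (ξ.xiLocalChar v) (isOpen_ker_xiLocalChar L ξ v))).IsUnitarizable`
  — (U-2) + ★ `norm_xiLocalChar_apply_eq_one`; and the proof-irrelevant form `…_xiLocalChar' (hker)` for consumers carrying their own open-kernel proof.
HONEST LABEL: HC_CM is proved only modulo the 7 printed citations (2 remaining named inputs: hLiu418 = `stmt-HodgeConjecture-24832`, h413 = `stmt-HodgeConjecture-24833`) until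
rung 0 closes; REL ≠ ★ ≠ BUILT; a bookkeeping ★ helper — closes no socket; count-neutral.

## References
* [BushnellHenniart2006] C. J. Bushnell, G. Henniart, *The Local Langlands Conjecture for GL(2)*, Grundlehren 335 (2006), §1.5, §11.1.
* [Rogawski1990] J. D. Rogawski, *Automorphic Representations of Unitary Groups in Three Variables* (1990), §12.1 p. 171, §13.3 p. 202, §14.5 p. 238.
* [PlatonovRapinchuk1994] V. Platonov, A. Rapinchuk, *Algebraic Groups and Number Theory* (1994), §6.2 (characters of the compact torus `U(1)_{L∕L⁺}(𝔸)` are unitary).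
-/

set_option autoImplicit false
-- the mandated namespace repeats the single-problem summit's segment (`HodgeConjecture.HodgeConjecture`)
set_option linter.dupNamespace false

noncomputable section

open NumberField IsDedekindDomain
open Literature.NumberTheory.Automorphic Literature.NumberTheory.Automorphic.UnitaryGroup
open Literature.NumberTheory.Rogawski1990
open Summit.HodgeConjecture.HodgeConjecture.Cruxes.H413.F0P3XiLocalCharOpenKernel (isOpen_ker_xiLocalChar)

namespace Summit.HodgeConjecture.HodgeConjecture.R90.S5

/-! ## §1 Representation level: the twist of the trivial line by a UNITARY character is unitarizable -/

section Rep

universe u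

variable {G : Type u} [Group G]

/-- A `ℂ`-sesquilinear form scales by `conj a · a` under a common scalar. [cite: BushnellHenniart2006, §11.1] -/
private theorem sesq_smul_smul {V : Type*} [AddCommGroup V] [Module ℂ V] (B : V →ₗ⋆[ℂ] V →ₗ[ℂ] ℂ) (a : ℂ) (x y : V) :
    B (a • x) (a • y) = (starRingEnd ℂ a * a) * B x y := by
  rw [LinearMap.map_smulₛₗ₂, LinearMap.map_smul, smul_eq_mul, smul_eq_mul, mul_assoc]

/-- **A UNITARY character gives a unitarizable line**: if `‖χ(g)‖ = 1` for all `g`, the one-dimensional representation `ℂ_χ = (trivial ℂ G ℂ) ⊗ χ` is unitarizable —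
Mathlib's inner product on `ℂ` (★ `Representation.isUnitarizable_trivial`'s witness) is invariant since `B(χ(g)z, χ(g)w) = conj(χ g)·χ(g)·B(z,w) = ‖χ g‖²·B(z,w)`.  Converse of ★
`Representation.norm_eq_one_of_isUnitarizable_twist`. [cite: BushnellHenniart2006, §11.1; §1.5] -/
theorem isUnitarizable_trivial_twist_of_norm_eq_one (χ : G →* ℂˣ) (hu : ∀ g : G, ‖((χ g : ℂˣ) : ℂ)‖ = 1) :
    ((Representation.trivial ℂ G ℂ).twist χ).IsUnitarizable := by
  obtain ⟨B, hB, hpos, -⟩ := (Representation.isUnitarizable_trivial : (Representation.trivial ℂ G ℂ).IsUnitarizable)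
  refine ⟨B, hB, hpos, fun g z w => ?_⟩
  have hcc : starRingEnd ℂ ((χ g : ℂˣ) : ℂ) * ((χ g : ℂˣ) : ℂ) = 1 := by
    rw [← Complex.normSq_eq_conj_mul_self, Complex.normSq_eq_norm_sq, hu, one_pow, Complex.ofReal_one]
  rw [twist_trivial_apply, twist_trivial_apply, ← smul_eq_mul, ← smul_eq_mul, sesq_smul_smul, hcc, one_mul]

/-- **`ℂ_χ` is unitarizable iff `χ` is unitary** (§1 ∧ ★ `Representation.norm_eq_one_of_isUnitarizable_twist`). [cite: BushnellHenniart2006, §11.1] -/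
theorem isUnitarizable_trivial_twist_iff (χ : G →* ℂˣ) :
    ((Representation.trivial ℂ G ℂ).twist χ).IsUnitarizable ↔ ∀ g : G, ‖((χ g : ℂˣ) : ℂ)‖ = 1 :=
  ⟨fun h g => Representation.norm_eq_one_of_isUnitarizable_twist h g, isUnitarizable_trivial_twist_of_norm_eq_one χ⟩

end Rep

/-! ## §2 Class level (U-2): `⟦ℂ_χ⟧ ∈ Irr(G)` is unitarizable for `χ` unitary with open kernel -/

section Cls

universe u

variable {G : Type u} [Group G] [TopologicalSpace G] [IsTopologicalGroup G]

/-- **(U-2) THE CLASS `⟦ℂ_χ⟧` OF A UNITARY SMOOTH CHARACTER IS UNITARIZABLE** (★ `IrrClass.IsUnitarizable` of ★ `SmoothIrrep.ofChar χ hχ`): the converse of ★ (U-1)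
`norm_eq_one_of_isUnitarizable_ofChar`; this is the term the (ℓ8) U-twins pass as `hu` at `r = ℂ_{ξ_v}`. [cite: BushnellHenniart2006, §11.1; §1.5] [cite: Rogawski1990, §12.1 p. 171] -/
theorem isUnitarizable_mk_ofChar_of_norm_eq_one (χ : G →* ℂˣ) (hχ : IsOpen ((χ.ker : Subgroup G) : Set G)) (hu : ∀ g : G, ‖((χ g : ℂˣ) : ℂ)‖ = 1) :
    (IrrClass.mk (SmoothIrrep.ofChar χ hχ)).IsUnitarizable := by
  rw [IrrClass.isUnitarizable_mk, SmoothIrrep.ofChar_ρ]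
  exact isUnitarizable_trivial_twist_of_norm_eq_one χ hu

/-- **`⟦ℂ_χ⟧` is unitarizable iff `χ` is unitary** — (U-2) ∧ ★ (U-1) `norm_eq_one_of_isUnitarizable_ofChar`. [cite: BushnellHenniart2006, §11.1] [cite: Rogawski1990, §14.5 p. 238] -/
theorem isUnitarizable_mk_ofChar_iff (χ : G →* ℂˣ) (hχ : IsOpen ((χ.ker : Subgroup G) : Set G)) :
    (IrrClass.mk (SmoothIrrep.ofChar χ hχ)).IsUnitarizable ↔ ∀ g : G, ‖((χ g : ℂˣ) : ℂ)‖ = 1 :=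
  ⟨fun h g => norm_eq_one_of_isUnitarizable_ofChar χ hχ h g, isUnitarizable_mk_ofChar_of_norm_eq_one χ hχ⟩

end Cls

/-! ## §3 (U-2ξ): Rogawski's `ξ_v` on `H_v = U(Φ₂)(L⁺_v) × U(Φ₁)(L⁺_v)` -/

section Xi

variable (L : Type) [Field L] [NumberField L] [IsCMField L]

/-- **(U-2ξ) `⟦ℂ_{ξ_v}⟧` IS UNITARIZABLE** for every one-dimensional automorphic `ξ` of `H` (★ `OneDimAutRepH`) and every finite place `v`: `ξ_v` (★ `xiLocalChar`) is unitary (★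
`norm_xiLocalChar_apply_eq_one`: `η, ψ` are characters of the compact torus `U(1)_{L∕L⁺}`) and has open kernel (★ `isOpen_ker_xiLocalChar`), so (U-2) applies.  The exact `hu` every
`rhoXiU` ∕ `charPacketU` ∕ `packetHOfOneDimU` twin of the (ℓ8) cascade passes (LEAD #33 (B)). [cite: Rogawski1990, §13.3 p. 202; §12.1 p. 171] [cite: PlatonovRapinchuk1994, §6.2] -/
theorem isUnitarizable_mk_ofChar_xiLocalChar (ξ : OneDimAutRepH L) (v : HeightOneSpectrum (𝓞 ↥(maximalRealSubfield L))) :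
    (IrrClass.mk (SmoothIrrep.ofChar (ξ.xiLocalChar v) (isOpen_ker_xiLocalChar L ξ v))).IsUnitarizable :=
  isUnitarizable_mk_ofChar_of_norm_eq_one (ξ.xiLocalChar v) (isOpen_ker_xiLocalChar L ξ v) (OneDimAutRepH.norm_xiLocalChar_apply_eq_one ξ v)

/-- **(U-2ξ), proof-irrelevant form**: the same for ANY open-kernel proof `hker` the consumer carries (e.g. the `hker` binder of ★ `F0P3bHPrincipalSeriesJHHolds`).
[cite: Rogawski1990, §13.3 p. 202; §12.1 p. 171] -/
theorem isUnitarizable_mk_ofChar_xiLocalChar' (ξ : OneDimAutRepH L) (v : HeightOneSpectrum (𝓞 ↥(maximalRealSubfield L)))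
    (hker : IsOpen ((((ξ.xiLocalChar v).ker : Subgroup
      ((UnitaryGroup.cmDatum L 2 (Matrix.of fun i j : Fin 2 => if i.val + j.val + 1 = 2 then (1 : L) else 0)).Local v ×
        (UnitaryGroup.cmDatum L 1 (Matrix.of fun i j : Fin 1 => if i.val + j.val + 1 = 1 then (1 : L) else 0)).Local v)) :
      Set ((UnitaryGroup.cmDatum L 2 (Matrix.of fun i j : Fin 2 => if i.val + j.val + 1 = 2 then (1 : L) else 0)).Local v ×
        (UnitaryGroup.cmDatum L 1 (Matrix.of fun i j : Fin 1 => if i.val + j.val + 1 = 1 then (1 : L) else 0)).Local v)))) :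
    (IrrClass.mk (SmoothIrrep.ofChar (ξ.xiLocalChar v) hker)).IsUnitarizable :=
  isUnitarizable_mk_ofChar_of_norm_eq_one (ξ.xiLocalChar v) hker (OneDimAutRepH.norm_xiLocalChar_apply_eq_one ξ v)

end Xi

end Summit.HodgeConjecture.HodgeConjecture.R90.S5

end
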